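import Summits.QuantumFields.YangMills.Theorems.BalabanLadderIRTwistedSpectralDatum
import HarnessLib

/-!
# Equipartition seam, thick species — the PEELING theorem in the eigen-data ∕ `HasSum` currency (PORT, 0 sorry, no defs)

Helper for crux `IRcof` (stmt-QuantumFields-26930), census row 47 «equipartition-seam» (skeleton rev 7 b786d9ea556a, custody
ym-ir-idea-22).  PORT requested by the critic of record (ym-ir-crit-3 g5, STAMP condition C-i on idea-22 g6's rev-8 proposal,
2026-08-29): idea-22 g6's matrix-level peeling theorem (`Cruxes/IRcof/Lines/equipartition_seam_ThickSpecies.lean` 765207cc8487: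
`insertion_fluxUniform` ∕ `eblind_thick` ∕ `eblind_thick_re` ∕ `eblind_thick_pow`, over `Matrix n n ℂ`) restated and PROVED over the
infinite-dimensional currency the slot's transfer operators and the tree's twisted spectral data use
(`TwistCost.HasTwistedSpectralDatum`, idea-22's `FluxInsertion.HasInsertedTwistedSpectralDatum`, pool-p3's `TraceHolder`):
an arbitrary index type `ι` (joint eigenbasis), eigenvalues `xᵢ ≥ 0` of the PSD block `X = 𝕋^s`, multiplicative unit flux labels
`χᵢ : Zc → ℂ` of the finite abelian twist group `Zc`, and — the ONLY datum of the dressed insertion `𝔹` that is used — its DIAGONAL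
matrix elements `dᵢ = ⟨bᵢ, 𝔹 bᵢ⟩ ∈ ℂ` with `‖dᵢ‖ ≤ β` (`β` = an operator-norm bound; no positivity, no commutation of `𝔹`, so crit-3's
two-state witness `𝕋M₁𝕋M₂𝕋 ⋠ K𝕋³` is honoured).  Twisted traces `Xtr c = Σᵢ χᵢ(c)·xᵢ`, inserted traces `W c = Σᵢ χᵢ(c)·xᵢ·dᵢ`
(`HasSum`s); the second block `Y = 𝕋^{s+r}` enters ONLY through its twisted traces `Z : Zc → ℂ`, equipartitioned around `Z₀ ≥ 0`.

* §1 `charSum_dichotomy`, `trivMassWeight_*` — for a multiplicative unit character `χ` on a finite group, `Σ_c χ(c)` is `|Zc|`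
  (χ trivial) or `0`; the weight `t(χ) := 1 − Re(Σ_c χ c)/|Zc| ∈ {0,1}` flags the NON-TRIVIAL fluxes and `‖χ(c) − 1‖ ≤ 2·t(χ)`.
* §2 ★ `nontrivialMass_le_of_equipartition` — EQUI `‖Xtr c − X₁‖ ≤ δ·X₁` forces the eigenvalue MASS carried by non-trivial fluxes
  to be small: `Σᵢ t(χᵢ)·xᵢ ≤ δ·X₁` (average EQUI over the group: `Σ_c (X₁ − Xtr c) = |Zc|·Σᵢ t(χᵢ)xᵢ` — the dichotomy, no dual group,
  no Fourier inversion).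
* §3 ★ `insertion_fluxUniform` — hence `‖W c − W 1‖ ≤ 2·β·δ·X₁` and `‖W 1‖ ≤ β·X₁` (constant `2`, where the matrix version had `2|α|`).
* §4 `pairBound_of_uniform` (bookkeeping, verbatim port) and ★★ `eblind_thick` — with the SLACK `β·X₁ ≤ K·Z₀` and `0 ≤ δ ≤ 1`:
  `‖W a·Z b − W b·Z a‖ ≤ 10·K·δ·Z₀²` (RATE PRESERVED; constant `10` replaces `8|α| + 2`); `eblind_thick_re` — the `p_z·p_w` shape
  `≤ 40·K·δ·Re(Z a)·Re(Z b)` for `δ ≤ 1/2`.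
* §5 `eblind_thick_pow` — the transfer reading: `xᵢ = λᵢ^s`, `Z` the twisted traces of `λᵢ^{s+r}`, `λᵢ ≤ Λ`, `‖dᵢ‖ ≤ a·Λ^r`
  (kernel domination `‖𝔹_A‖ ≤ ‖A‖_∞‖𝕋^r‖`), VACUUM THERMAL SLACK `Λ^r·X₁ ≤ C·Z₀` ⟹ `K = a·C`.

What stays with the consumer (D of rev 8): the identification of the split-weight sector integrals with these `HasSum`s (joint
eigenbasis of the commuting family `𝕋`, `U_c`; `dᵢ = ⟨bᵢ, 𝔹_A bᵢ⟩`), i.e. exactly idea-22's datum and nothing finite-dimensional.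
HONEST: bookkeeping port; nothing located (S3ʷ, T, D, N, S1, S5ᵛ) is proved; width toward PXcof ∕ N_cof ∕ `IRcof` ∕ `IR` is 0;
the Yang–Mills mass gap (Clay) is NOT proved anywhere in this tree; R4 closes only the conditional finite-𝕋⁴ rung `BalabanLadder.UV`.
Written by pool prover ym-ir-line-pool-p3 g16 (director №40 lane: row-47 helpers on signatures posted by idea-22 ∕ the critic).
-/

set_option autoImplicit false

noncomputable section

namespace Summit.QuantumFields.YangMills.Cruxes.IRcof.EquipartitionSeam.ThickSpeciesDatum

open scoped BigOperators
open Finset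
open Summit.QuantumFields.YangMills.Cruxes.IR.TwistCost (char_trivial_or_sum_eq_zero)

variable {Zc : Type} [CommGroup Zc] [Fintype Zc]

/-! ## §1 Character sums and the non-trivial-flux weight -/

section CharSum

omit [Fintype Zc] in
/-- A multiplicative unit-valued `χ` has `χ 1 = 1` (`χ 1 = χ 1 · χ 1` and `χ 1 ≠ 0`). -/
theorem char_one (χ : Zc → ℂ) (hmul : ∀ a b, χ (a * b) = χ a * χ b) (hnorm : ∀ a, ‖χ a‖ = 1) : χ 1 = 1 := by
  have h1 : χ 1 * χ 1 = χ 1 * 1 := by rw [mul_one, ← hmul, mul_one]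
  have hne : χ 1 ≠ 0 := fun h => by simpa [h] using hnorm 1
  exact mul_left_cancel₀ hne h1

/-- **Dichotomy of the character sum**: `Σ_c χ c = |Zc|` if `χ` is trivial, `= 0` otherwise (tree: `char_trivial_or_sum_eq_zero`). -/
theorem charSum_dichotomy (χ : Zc → ℂ) (hmul : ∀ a b, χ (a * b) = χ a * χ b) :
    ((∀ c, χ c = 1) ∧ ∑ c, χ c = (Fintype.card Zc : ℂ)) ∨ ((¬ ∀ c, χ c = 1) ∧ ∑ c, χ c = 0) := by
  rcases char_trivial_or_sum_eq_zero χ hmul with h | h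
  · left
    refine ⟨h, ?_⟩
    rw [Finset.sum_congr rfl (fun c _ => h c)]
    simp
  · right
    refine ⟨fun htriv => ?_, h⟩
    rw [Finset.sum_congr rfl (fun c _ => htriv c)] at h
    simp at h

/-- The **non-trivial-flux weight** of a character: `t(χ) = 1 − Re(Σ_c χ c)/|Zc|`; it is `0` for the trivial character and `1`
otherwise (no decidability of triviality is needed to DEFINE it). -/
theorem trivMassWeight_eq_zero_or_one (χ : Zc → ℂ) (hmul : ∀ a b, χ (a * b) = χ a * χ b) :
    (1 - (∑ c, χ c).re / (Fintype.card Zc : ℝ) = 0 ∧ ∀ c, χ c = 1) ∨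
      (1 - (∑ c, χ c).re / (Fintype.card Zc : ℝ) = 1 ∧ ¬ ∀ c, χ c = 1) := by
  have hcard : (Fintype.card Zc : ℝ) ≠ 0 := Nat.cast_ne_zero.mpr Fintype.card_ne_zero
  rcases charSum_dichotomy χ hmul with ⟨ht, hs⟩ | ⟨hnt, hs⟩
  · left
    refine ⟨?_, ht⟩
    rw [hs]
    simp [hcard]
  · right
    refine ⟨?_, hnt⟩
    rw [hs]
    simp

/-- `0 ≤ t(χ) ≤ 1`. -/
theorem trivMassWeight_mem (χ : Zc → ℂ) (hmul : ∀ a b, χ (a * b) = χ a * χ b) :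
    0 ≤ 1 - (∑ c, χ c).re / (Fintype.card Zc : ℝ) ∧ 1 - (∑ c, χ c).re / (Fintype.card Zc : ℝ) ≤ 1 := by
  rcases trivMassWeight_eq_zero_or_one χ hmul with ⟨h, -⟩ | ⟨h, -⟩ <;> rw [h] <;> norm_num

/-- **`‖χ(c) − 1‖ ≤ 2·t(χ)`**: zero for the trivial character, `≤ ‖χ c‖ + 1 = 2` otherwise. -/
theorem norm_char_sub_one_le (χ : Zc → ℂ) (hmul : ∀ a b, χ (a * b) = χ a * χ b) (hnorm : ∀ a, ‖χ a‖ = 1) (c : Zc) :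
    ‖χ c - 1‖ ≤ 2 * (1 - (∑ c, χ c).re / (Fintype.card Zc : ℝ)) := by
  rcases trivMassWeight_eq_zero_or_one χ hmul with ⟨h, ht⟩ | ⟨h, -⟩
  · rw [h, ht c]; simp
  · rw [h, mul_one]
    calc ‖χ c - 1‖ ≤ ‖χ c‖ + ‖(1 : ℂ)‖ := norm_sub_le _ _
      _ = 2 := by rw [hnorm, norm_one]; norm_num

/-- The complex identity `|Zc| − Σ_c χ c = |Zc| · t(χ)` (the character sum is real in both cases of the dichotomy). -/
theorem card_sub_charSum_eq (χ : Zc → ℂ) (hmul : ∀ a b, χ (a * b) = χ a * χ b) :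
    (Fintype.card Zc : ℂ) - ∑ c, χ c = (Fintype.card Zc : ℂ) * (((1 - (∑ c, χ c).re / (Fintype.card Zc : ℝ) : ℝ)) : ℂ) := by
  rcases trivMassWeight_eq_zero_or_one χ hmul with ⟨h, ht⟩ | ⟨h, hnt⟩
  · rw [h]
    rcases charSum_dichotomy χ hmul with ⟨-, hs⟩ | ⟨hnt', -⟩
    · rw [hs]; simp
    · exact absurd ht hnt'
  · rw [h]
    rcases charSum_dichotomy χ hmul with ⟨ht', -⟩ | ⟨-, hs⟩
    · exact absurd ht' hnt
    · rw [hs]; simp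

end CharSum

/-! ## §2 Equipartition forces the non-trivial-flux mass to be small -/

section Mass

variable {ι : Type}

/-- **★ Non-trivial-flux mass from equipartition.**  Eigen-data `xᵢ ≥ 0` with flux labels `χᵢ` (multiplicative, unit-valued),
twisted traces `HasSum (χᵢ c · xᵢ) (Xtr c)` and `HasSum xᵢ X₁`, equipartition `‖Xtr c − X₁‖ ≤ δ·X₁` for every twist `c`.  Then the
weighted mass `Σᵢ t(χᵢ)·xᵢ` (= the mass of the indices with NON-TRIVIAL flux) is summable with sum `≤ δ·X₁`.
Proof: `Σ_c (X₁ − Xtr c) = Σᵢ (|Zc| − Σ_c χᵢ c)·xᵢ = |Zc|·Σᵢ t(χᵢ)xᵢ` and `‖Σ_c (X₁ − Xtr c)‖ ≤ |Zc|·δ·X₁`. -/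
theorem nontrivialMass_le_of_equipartition (x : ι → ℝ) (hx : ∀ i, 0 ≤ x i) (χ : ι → Zc → ℂ)
    (hmul : ∀ i a b, χ i (a * b) = χ i a * χ i b) {Xtr : Zc → ℂ} {X₁ δ : ℝ}
    (hX : ∀ c, HasSum (fun i => χ i c * (x i : ℂ)) (Xtr c)) (hX1 : HasSum x X₁)
    (hequi : ∀ c, ‖Xtr c - (X₁ : ℂ)‖ ≤ δ * X₁) :
    ∃ M : ℝ, HasSum (fun i => (1 - (∑ c, χ i c).re / (Fintype.card Zc : ℝ)) * x i) M ∧ 0 ≤ M ∧ M ≤ δ * X₁ := by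
  set t : ι → ℝ := fun i => 1 - (∑ c, χ i c).re / (Fintype.card Zc : ℝ) with ht
  have ht01 : ∀ i, 0 ≤ t i ∧ t i ≤ 1 := fun i => trivMassWeight_mem (χ i) (hmul i)
  -- summability of the weighted mass by comparison with `x`
  have hsum : Summable (fun i => t i * x i) := by
    refine Summable.of_nonneg_of_le (fun i => mul_nonneg (ht01 i).1 (hx i)) (fun i => ?_) hX1.summable
    calc t i * x i ≤ 1 * x i := mul_le_mul_of_nonneg_right (ht01 i).2 (hx i)
      _ = x i := one_mul _
  set M : ℝ := ∑' i, t i * x i with hM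
  have hMsum : HasSum (fun i => t i * x i) M := hsum.hasSum
  refine ⟨M, hMsum, ?_, ?_⟩
  · exact hMsum.nonneg (fun i => mul_nonneg (ht01 i).1 (hx i))
  · -- `Σ_c (X₁ − Xtr c) = |Zc| · M` as complex numbers
    have hX1C : HasSum (fun i => ((x i : ℝ) : ℂ)) ((X₁ : ℝ) : ℂ) := by
      simpa using (Complex.ofRealCLM.hasSum hX1)
    have hdiff : ∀ c, HasSum (fun i => ((x i : ℂ)) - χ i c * (x i : ℂ)) ((X₁ : ℂ) - Xtr c) :=
      fun c => hX1C.sub (hX c)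
    have hS : HasSum (fun i => ∑ c, (((x i : ℂ)) - χ i c * (x i : ℂ))) (∑ c, ((X₁ : ℂ) - Xtr c)) :=
      hasSum_sum (fun c _ => hdiff c)
    have hterm : ∀ i, ∑ c, (((x i : ℂ)) - χ i c * (x i : ℂ)) = (Fintype.card Zc : ℂ) * ((t i * x i : ℝ) : ℂ) := by
      intro i
      have h1 : ∑ c, (((x i : ℂ)) - χ i c * (x i : ℂ)) = ((Fintype.card Zc : ℂ) - ∑ c, χ i c) * (x i : ℂ) := by
        rw [Finset.sum_sub_distrib, Finset.sum_const, Finset.card_univ, nsmul_eq_mul, ← Finset.sum_mul, sub_mul]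
      rw [h1, card_sub_charSum_eq (χ i) (hmul i)]
      simp only [ht]
      push_cast
      ring
    have hS' : HasSum (fun i => (Fintype.card Zc : ℂ) * ((t i * x i : ℝ) : ℂ)) (∑ c, ((X₁ : ℂ) - Xtr c)) :=
      hS.congr_fun (fun i => (hterm i).symm)
    have hMC : HasSum (fun i => (Fintype.card Zc : ℂ) * ((t i * x i : ℝ) : ℂ)) ((Fintype.card Zc : ℂ) * (M : ℂ)) := by
      have h := (Complex.ofRealCLM.hasSum hMsum)
      simpa using h.mul_left (Fintype.card Zc : ℂ)
    have hEq : ∑ c, ((X₁ : ℂ) - Xtr c) = (Fintype.card Zc : ℂ) * (M : ℂ) := hS'.unique hMC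
    -- norm bound
    have hcardpos : (0 : ℝ) < Fintype.card Zc := Nat.cast_pos.mpr Fintype.card_pos
    have hM0 : 0 ≤ M := hMsum.nonneg (fun i => mul_nonneg (ht01 i).1 (hx i))
    have hnorm : (Fintype.card Zc : ℝ) * M ≤ (Fintype.card Zc : ℝ) * (δ * X₁) := by
      have h1 : ‖(Fintype.card Zc : ℂ) * (M : ℂ)‖ = (Fintype.card Zc : ℝ) * M := by
        rw [norm_mul, Complex.norm_natCast, Complex.norm_real, Real.norm_eq_abs, abs_of_nonneg hM0]
      rw [← h1, ← hEq]
      calc ‖∑ c, ((X₁ : ℂ) - Xtr c)‖ ≤ ∑ c, ‖(X₁ : ℂ) - Xtr c‖ := norm_sum_le _ _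
        _ ≤ ∑ _c : Zc, δ * X₁ := Finset.sum_le_sum (fun c _ => by rw [norm_sub_rev]; exact hequi c)
        _ = (Fintype.card Zc : ℝ) * (δ * X₁) := by rw [Finset.sum_const, Finset.card_univ, nsmul_eq_mul]
    exact le_of_mul_le_mul_left hnorm hcardpos

end Mass

/-! ## §3 Flux-uniformity of the inserted traces -/

section Insertion

variable {ι : Type}

/-- **★ Peeling, step 1 — flux-uniformity of a dressed insertion (eigen-data form).**  With the data of
`nontrivialMass_le_of_equipartition`, diagonal insertion coefficients `‖dᵢ‖ ≤ β` and inserted traces `HasSum (χᵢ c·xᵢ·dᵢ) (W c)`: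
`‖W c − W 1‖ ≤ 2·β·δ·X₁` for every twist `c`.  (Matrix version: `ThickSpecies.insertion_fluxUniform` with `2|α|`; here the
group average gives the constant `2`.) -/
theorem insertion_fluxUniform (x : ι → ℝ) (hx : ∀ i, 0 ≤ x i) (χ : ι → Zc → ℂ)
    (hmul : ∀ i a b, χ i (a * b) = χ i a * χ i b) (hnorm : ∀ i a, ‖χ i a‖ = 1) (d : ι → ℂ) {β : ℝ}
    (hd : ∀ i, ‖d i‖ ≤ β) {Xtr W : Zc → ℂ} {X₁ δ : ℝ}
    (hX : ∀ c, HasSum (fun i => χ i c * (x i : ℂ)) (Xtr c)) (hX1 : HasSum x X₁)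
    (hW : ∀ c, HasSum (fun i => χ i c * (x i : ℂ) * d i) (W c))
    (hequi : ∀ c, ‖Xtr c - (X₁ : ℂ)‖ ≤ δ * X₁) (c : Zc) :
    ‖W c - W 1‖ ≤ 2 * β * δ * X₁ := by
  obtain ⟨M, hM, hM0, hMle⟩ := nontrivialMass_le_of_equipartition x hx χ hmul hX hX1 hequi
  have hβ : ∀ i, 0 ≤ β := fun i => (norm_nonneg _).trans (hd i)
  have h1 : ∀ i, χ i 1 = 1 := fun i => char_one (χ i) (hmul i) (hnorm i)
  have hdiff : HasSum (fun i => (χ i c - 1) * (x i : ℂ) * d i) (W c - W 1) := by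
    have h := (hW c).sub (hW 1)
    refine h.congr_fun (fun i => ?_)
    rw [h1 i]
    ring
  have hbound : HasSum (fun i => 2 * β * ((1 - (∑ c, χ i c).re / (Fintype.card Zc : ℝ)) * x i)) (2 * β * M) :=
    hM.mul_left (2 * β)
  have hle : ‖W c - W 1‖ ≤ 2 * β * M := by
    refine hdiff.norm_le_of_bounded hbound (fun i => ?_)
    rw [norm_mul, norm_mul, Complex.norm_real, Real.norm_eq_abs, abs_of_nonneg (hx i)]
    have hχ := norm_char_sub_one_le (χ i) (hmul i) (hnorm i) c
    have ht0 : 0 ≤ 1 - (∑ c, χ i c).re / (Fintype.card Zc : ℝ) := (trivMassWeight_mem (χ i) (hmul i)).1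
    calc ‖χ i c - 1‖ * x i * ‖d i‖ ≤ (2 * (1 - (∑ c, χ i c).re / (Fintype.card Zc : ℝ))) * x i * β :=
          mul_le_mul (mul_le_mul_of_nonneg_right hχ (hx i)) (hd i) (norm_nonneg _)
            (mul_nonneg (mul_nonneg (by norm_num) ht0) (hx i))
      _ = 2 * β * ((1 - (∑ c, χ i c).re / (Fintype.card Zc : ℝ)) * x i) := by ring
  rcases isEmpty_or_nonempty ι with hι | ⟨⟨i₀⟩⟩
  · -- no indices: everything vanishes
    have hW0 : ∀ c', W c' = 0 := fun c' => (hW c').unique hasSum_empty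
    rw [hW0 c, hW0 1, sub_self, norm_zero]
    have hX10 : X₁ = 0 := hX1.unique hasSum_empty
    rw [hX10]; simp
  · calc ‖W c - W 1‖ ≤ 2 * β * M := hle
      _ ≤ 2 * β * (δ * X₁) := mul_le_mul_of_nonneg_left hMle (mul_nonneg (by norm_num) (hβ i₀))
      _ = 2 * β * δ * X₁ := by ring

omit [Fintype Zc] in
/-- The untwisted inserted trace is bounded by the insertion bound: `‖W 1‖ ≤ β·X₁`. -/
theorem norm_insertion_le (x : ι → ℝ) (hx : ∀ i, 0 ≤ x i) (χ : ι → Zc → ℂ)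
    (hmul : ∀ i a b, χ i (a * b) = χ i a * χ i b) (hnorm : ∀ i a, ‖χ i a‖ = 1) (d : ι → ℂ) {β : ℝ}
    (hd : ∀ i, ‖d i‖ ≤ β) {W : Zc → ℂ} {X₁ : ℝ} (hX1 : HasSum x X₁)
    (hW : ∀ c, HasSum (fun i => χ i c * (x i : ℂ) * d i) (W c)) : ‖W 1‖ ≤ β * X₁ := by
  have h1 : ∀ i, χ i 1 = 1 := fun i => char_one (χ i) (hmul i) (hnorm i)
  have hW1 : HasSum (fun i => (x i : ℂ) * d i) (W 1) := (hW 1).congr_fun (fun i => by rw [h1 i, one_mul])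
  refine hW1.norm_le_of_bounded (hX1.mul_left β) (fun i => ?_)
  rw [norm_mul, Complex.norm_real, Real.norm_eq_abs, abs_of_nonneg (hx i), mul_comm]
  exact mul_le_mul_of_nonneg_right (hd i) (hx i)

end Insertion

/-! ## §4 The peeling theorem: EBLIND cross difference for a thick species -/

section Peeling

variable {ι : Type}

omit [CommGroup Zc] [Fintype Zc] in
/-- **Cross-difference bookkeeping** (verbatim port of `ThickSpecies.pairBound_of_uniform`): `‖W_x − W₀‖ ≤ ε`, `‖W₀‖ ≤ w`,
`‖Z_x − Z₀‖ ≤ δ Z₀` (`Z₀ ≥ 0`) ⟹ `‖W_x Z_y − W_y Z_x‖ ≤ 2ε(1+δ)Z₀ + 2wδZ₀`. -/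
theorem pairBound_of_uniform (W Z : Zc → ℂ) (W₀ : ℂ) (Z₀ ε w δ : ℝ) (hZ₀ : 0 ≤ Z₀)
    (hW : ∀ x, ‖W x - W₀‖ ≤ ε) (hw : ‖W₀‖ ≤ w) (hZ : ∀ x, ‖Z x - (Z₀ : ℂ)‖ ≤ δ * Z₀) (x y : Zc) :
    ‖W x * Z y - W y * Z x‖ ≤ 2 * ε * ((1 + δ) * Z₀) + 2 * w * δ * Z₀ := by
  have hε : 0 ≤ ε := (norm_nonneg _).trans (hW x)
  have hw0 : 0 ≤ w := (norm_nonneg _).trans hw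
  have hZn : ∀ u, ‖Z u‖ ≤ (1 + δ) * Z₀ := fun u => by
    have hsplit : Z u = (Z u - (Z₀ : ℂ)) + (Z₀ : ℂ) := by ring
    calc ‖Z u‖ = ‖(Z u - (Z₀ : ℂ)) + (Z₀ : ℂ)‖ := by rw [← hsplit]
      _ ≤ ‖Z u - (Z₀ : ℂ)‖ + ‖(Z₀ : ℂ)‖ := norm_add_le _ _
      _ ≤ δ * Z₀ + Z₀ := by
          rw [Complex.norm_real, Real.norm_eq_abs, abs_of_nonneg hZ₀]
          exact add_le_add (hZ u) le_rfl
      _ = (1 + δ) * Z₀ := by ring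
  have hZd : ‖Z y - Z x‖ ≤ 2 * δ * Z₀ := by
    have hsplit : Z y - Z x = (Z y - (Z₀ : ℂ)) - (Z x - (Z₀ : ℂ)) := by ring
    calc ‖Z y - Z x‖ = ‖(Z y - (Z₀ : ℂ)) - (Z x - (Z₀ : ℂ))‖ := by rw [← hsplit]
      _ ≤ ‖Z y - (Z₀ : ℂ)‖ + ‖Z x - (Z₀ : ℂ)‖ := norm_sub_le _ _
      _ ≤ δ * Z₀ + δ * Z₀ := add_le_add (hZ y) (hZ x)
      _ = 2 * δ * Z₀ := by ring
  have key : W x * Z y - W y * Z x = (W x - W₀) * Z y - (W y - W₀) * Z x + W₀ * (Z y - Z x) := by ring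
  rw [key]
  calc ‖(W x - W₀) * Z y - (W y - W₀) * Z x + W₀ * (Z y - Z x)‖
      ≤ ‖(W x - W₀) * Z y - (W y - W₀) * Z x‖ + ‖W₀ * (Z y - Z x)‖ := norm_add_le _ _
    _ ≤ ‖(W x - W₀) * Z y‖ + ‖(W y - W₀) * Z x‖ + ‖W₀ * (Z y - Z x)‖ :=
        add_le_add (norm_sub_le _ _) le_rfl
    _ = ‖W x - W₀‖ * ‖Z y‖ + ‖W y - W₀‖ * ‖Z x‖ + ‖W₀‖ * ‖Z y - Z x‖ := by simp only [norm_mul]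
    _ ≤ ε * ((1 + δ) * Z₀) + ε * ((1 + δ) * Z₀) + w * (2 * δ * Z₀) := by
        refine add_le_add (add_le_add ?_ ?_) ?_
        · exact mul_le_mul (hW x) (hZn y) (norm_nonneg _) hε
        · exact mul_le_mul (hW y) (hZn x) (norm_nonneg _) hε
        · exact mul_le_mul hw hZd (norm_nonneg _) hw0
    _ = 2 * ε * ((1 + δ) * Z₀) + 2 * w * δ * Z₀ := by ring

/-- **★★ PEELING THEOREM, eigen-data form (electric blindness for a thick species).**  Eigen-data of the PSD block `X = 𝕋^s`:
`xᵢ ≥ 0` with multiplicative unit flux labels `χᵢ : Zc → ℂ`, twisted traces `HasSum (χᵢ c·xᵢ) (Xtr c)`, `HasSum xᵢ X₁`,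
EQUIPARTITION `‖Xtr c − X₁‖ ≤ δ·X₁`; a dressed insertion known ONLY through its diagonal coefficients `‖dᵢ‖ ≤ β`, inserted traces
`HasSum (χᵢ c·xᵢ·dᵢ) (W c)`; a second block known ONLY through its twisted traces `Z : Zc → ℂ`, equipartitioned around the real
`Z₀ ≥ 0`: `‖Z c − Z₀‖ ≤ δ·Z₀`; `0 ≤ δ ≤ 1`; and the SLACK `β·X₁ ≤ K·Z₀`.  Then for all twists `a, b`:
`‖W a·Z b − W b·Z a‖ ≤ 10·K·δ·Z₀²` — RATE PRESERVED (one factor `δ`), constant linear in `K`.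
(Port of `ThickSpecies.eblind_thick`, whose constant is `8|α| + 2`.) -/
theorem eblind_thick (x : ι → ℝ) (hx : ∀ i, 0 ≤ x i) (χ : ι → Zc → ℂ)
    (hmul : ∀ i a b, χ i (a * b) = χ i a * χ i b) (hnorm : ∀ i a, ‖χ i a‖ = 1) (d : ι → ℂ) {β : ℝ}
    (hd : ∀ i, ‖d i‖ ≤ β) {Xtr W Z : Zc → ℂ} {X₁ Z₀ δ K : ℝ}
    (hX : ∀ c, HasSum (fun i => χ i c * (x i : ℂ)) (Xtr c)) (hX1 : HasSum x X₁)
    (hW : ∀ c, HasSum (fun i => χ i c * (x i : ℂ) * d i) (W c))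
    (hequiX : ∀ c, ‖Xtr c - (X₁ : ℂ)‖ ≤ δ * X₁) (hZ₀ : 0 ≤ Z₀) (hequiZ : ∀ c, ‖Z c - (Z₀ : ℂ)‖ ≤ δ * Z₀)
    (hδ : 0 ≤ δ) (hδ1 : δ ≤ 1) (hslack : β * X₁ ≤ K * Z₀) (a b : Zc) :
    ‖W a * Z b - W b * Z a‖ ≤ 10 * K * δ * Z₀ ^ 2 := by
  have hWu : ∀ u, ‖W u - W 1‖ ≤ 2 * β * δ * X₁ :=
    fun u => insertion_fluxUniform x hx χ hmul hnorm d hd hX hX1 hW hequiX u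
  have hw : ‖W 1‖ ≤ β * X₁ := norm_insertion_le x hx χ hmul hnorm d hd hX1 hW
  have h := pairBound_of_uniform W Z (W 1) Z₀ (2 * β * δ * X₁) (β * X₁) δ hZ₀ hWu hw hequiZ a b
  refine h.trans ?_
  have hβX : 0 ≤ β * X₁ := (norm_nonneg _).trans hw
  calc 2 * (2 * β * δ * X₁) * ((1 + δ) * Z₀) + 2 * (β * X₁) * δ * Z₀
      = (4 * (1 + δ) + 2) * (δ * Z₀) * (β * X₁) := by ring
    _ ≤ (4 * 2 + 2) * (δ * Z₀) * (K * Z₀) := by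
        have h1 : 4 * (1 + δ) + 2 ≤ (4 * 2 + 2 : ℝ) := by linarith
        have h2 : (0 : ℝ) ≤ 4 * (1 + δ) + 2 := by linarith
        have h3 : 0 ≤ δ * Z₀ := mul_nonneg hδ hZ₀
        gcongr
    _ = 10 * K * δ * Z₀ ^ 2 := by ring

/-- **The `p_z·p_w` shape** (`δ ≤ 1/2`): `Re(Z c) ≥ (1 − δ)Z₀ ≥ Z₀/2`, so `eblind_thick` reads
`‖W a·Z b − W b·Z a‖ ≤ 40·K·δ·Re(Z a)·Re(Z b)` — the shape of `EBlindUnitOn` after normalisation (port of `ThickSpecies.eblind_thick_re`). -/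
theorem eblind_thick_re (x : ι → ℝ) (hx : ∀ i, 0 ≤ x i) (χ : ι → Zc → ℂ)
    (hmul : ∀ i a b, χ i (a * b) = χ i a * χ i b) (hnorm : ∀ i a, ‖χ i a‖ = 1) (d : ι → ℂ) {β : ℝ}
    (hd : ∀ i, ‖d i‖ ≤ β) {Xtr W Z : Zc → ℂ} {X₁ Z₀ δ K : ℝ}
    (hX : ∀ c, HasSum (fun i => χ i c * (x i : ℂ)) (Xtr c)) (hX1 : HasSum x X₁)
    (hW : ∀ c, HasSum (fun i => χ i c * (x i : ℂ) * d i) (W c))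
    (hequiX : ∀ c, ‖Xtr c - (X₁ : ℂ)‖ ≤ δ * X₁) (hZ₀ : 0 ≤ Z₀) (hequiZ : ∀ c, ‖Z c - (Z₀ : ℂ)‖ ≤ δ * Z₀)
    (hδ : 0 ≤ δ) (hδ2 : δ ≤ 1 / 2) (hK : 0 ≤ K) (hslack : β * X₁ ≤ K * Z₀) (a b : Zc) :
    ‖W a * Z b - W b * Z a‖ ≤ 40 * K * δ * (Z a).re * (Z b).re := by
  have h := eblind_thick x hx χ hmul hnorm d hd hX hX1 hW hequiX hZ₀ hequiZ hδ (hδ2.trans (by norm_num)) hslack a b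
  have hlow : ∀ u, Z₀ ≤ 2 * (Z u).re := fun u => by
    have h1 : ((Z₀ : ℂ) - Z u).re ≤ ‖(Z₀ : ℂ) - Z u‖ := Complex.re_le_norm _
    have h2 : ‖(Z₀ : ℂ) - Z u‖ ≤ δ * Z₀ := by rw [norm_sub_rev]; exact hequiZ u
    have h3 : ((Z₀ : ℂ) - Z u).re = Z₀ - (Z u).re := by simp
    nlinarith
  refine h.trans ?_
  have hc : 0 ≤ 10 * K * δ := by positivity
  have hsq : Z₀ ^ 2 ≤ 4 * ((Z a).re * (Z b).re) := by
    have ha := hlow a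
    have hb := hlow b
    have ha0 : 0 ≤ (Z a).re := by linarith
    nlinarith [mul_le_mul ha hb hZ₀ (by linarith)]
  calc 10 * K * δ * Z₀ ^ 2 ≤ 10 * K * δ * (4 * ((Z a).re * (Z b).re)) := mul_le_mul_of_nonneg_left hsq hc
    _ = 40 * K * δ * (Z a).re * (Z b).re := by ring

end Peeling

/-! ## §5 The transfer reading: powers of one spectral datum, kernel domination and the vacuum thermal slack -/

section Powers

variable {ι : Type}

/-- **★ Peeling in the transfer reading (eigen-data form).**  ONE joint eigen-datum `(λᵢ, χᵢ)` of the split-weight transfer operator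
and the twists, `0 ≤ λᵢ ≤ Λ`; extent-`s` traces `Xtr`, `X₁` and extent-`(s+r)` traces `Z`, `Z₀` as `HasSum`s of `χᵢ c·λᵢ^s`,
`χᵢ c·λᵢ^{s+r}` (of the latter only `HasSum λᵢ^{s+r} Z₀` and the equipartition of `Z` are consumed); equipartition of BOTH
at defect `0 ≤ δ ≤ 1`; a dressed insertion of thickness `r` known through its diagonal
coefficients, DOMINATED as `‖dᵢ‖ ≤ a·Λ^r` (kernel domination `‖𝔹_A‖ ≤ ‖A‖_∞‖𝕋^r‖`, `‖𝕋^r‖ ≤ Λ^r`); and the VACUUM THERMAL SLACK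
`Λ^r·X₁ ≤ C·Z₀`.  Then `‖W a·Z b − W b·Z a‖ ≤ 10·(a·C)·δ·Z₀²` (port of `ThickSpecies.eblind_thick_pow`). -/
theorem eblind_thick_pow (lam : ι → ℝ) {Λ : ℝ} (hlam : ∀ i, 0 ≤ lam i ∧ lam i ≤ Λ) (χ : ι → Zc → ℂ)
    (hmul : ∀ i a b, χ i (a * b) = χ i a * χ i b) (hnorm : ∀ i a, ‖χ i a‖ = 1) (s r : ℕ) (d : ι → ℂ)
    {a C δ : ℝ} (ha : 0 ≤ a) (hd : ∀ i, ‖d i‖ ≤ a * Λ ^ r) {Xtr W Z : Zc → ℂ} {X₁ Z₀ : ℝ}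
    (hX : ∀ c, HasSum (fun i => χ i c * ((lam i ^ s : ℝ) : ℂ)) (Xtr c)) (hX1 : HasSum (fun i => lam i ^ s) X₁)
    (hW : ∀ c, HasSum (fun i => χ i c * ((lam i ^ s : ℝ) : ℂ) * d i) (W c))
    (hZ1 : HasSum (fun i => lam i ^ (s + r)) Z₀)
    (hequiX : ∀ c, ‖Xtr c - (X₁ : ℂ)‖ ≤ δ * X₁) (hequiZ : ∀ c, ‖Z c - (Z₀ : ℂ)‖ ≤ δ * Z₀)
    (hδ : 0 ≤ δ) (hδ1 : δ ≤ 1) (hslack : Λ ^ r * X₁ ≤ C * Z₀) (u v : Zc) :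
    ‖W u * Z v - W v * Z u‖ ≤ 10 * (a * C) * δ * Z₀ ^ 2 := by
  have hZ₀ : 0 ≤ Z₀ := hZ1.nonneg (fun i => pow_nonneg (hlam i).1 _)
  have hslack' : (a * Λ ^ r) * X₁ ≤ (a * C) * Z₀ := by
    calc (a * Λ ^ r) * X₁ = a * (Λ ^ r * X₁) := by ring
      _ ≤ a * (C * Z₀) := mul_le_mul_of_nonneg_left hslack ha
      _ = (a * C) * Z₀ := by ring
  exact eblind_thick (fun i => lam i ^ s) (fun i => pow_nonneg (hlam i).1 s) χ hmul hnorm d hd hX hX1 hW hequiX hZ₀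
    hequiZ hδ hδ1 hslack' u v

end Powers

end Summit.QuantumFields.YangMills.Cruxes.IRcof.EquipartitionSeam.ThickSpeciesDatum

end
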